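import Summits.CriticalPhenomena.SAWScalingLimit.Theorems.BoundaryTP2.Negative.TP2CertTaylor
import HarnessLib

/-!
# Crux `BoundaryTP2` (stmt-CriticalPhenomena-7115), line `Sketch`: `StripCert` part 1 — exact positivity of
integer polynomials on a rational interval (kernel-decidable)

Infrastructure for the lead's ALL-LENGTH strip certificates (transfer recursions + invariant box cones):
every analytic step reduces to finitely many statements `∀ x ∈ [α, β], P(x) ≥ 0` for integer coefficient
lists `P`.  Here such statements get a `Bool` test `posOn` and its soundness theorem, so that instances are
discharged by `decide` (kernel) — the human's CERTIFICATE OBJECTIVE ("exact rational, decide-able").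

The test: substitute `x = (a + m t)/D`, `t ∈ [0,1]` (`shiftH`, `scaleZ`), cut `[0,1)` into `N` cells
`t = (c + s)/N` (`shiftH` again), and on each cell use the transform
`G(u) = (1+u)^n Q(u/(1+u)) = Σ_j q_j u^j (1+u)^{n-j}` (`bernG`): if all coefficients of `G` are `≥ 0` then
`Q ≥ 0` on `[0,1)` (as `u = s/(1-s)` ranges over `[0,∞)`); the right end point `t = 1` is the coefficient sum.
Everything is proved (no `sorry`, no new axioms); the list primitives `evZ/addZ/smulZ/mulLinZ/mulZ/shiftH` are
the certified-compute seat's (…Negative.TP2CertTaylor). [folklore]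
-/

namespace Summit.CriticalPhenomena.SAWScalingLimit.Theorems.BoundaryTP2.StripCert

open Summit.CriticalPhenomena.SAWScalingLimit.Theorems.BoundaryTP2.Negative.Cert

/-! ## §1 More list-polynomial primitives -/

/-- Rescaling of the variable: `scaleZ m [p₀,p₁,p₂,…] = [p₀, m p₁, m² p₂, …]`, i.e. `P(m·s)`. [folklore] -/
def scaleZ (m : ℤ) : List ℤ → List ℤ
  | [] => []
  | c :: cs => c :: smulZ m (scaleZ m cs)

/-- `scaleZ` rescales the variable. [folklore] -/
theorem evZ_scaleZ (m : ℤ) : ∀ (P : List ℤ) (s : ℝ), evZ (scaleZ m P) s = evZ P (m * s)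
  | [], s => by simp [scaleZ]
  | c :: cs, s => by rw [scaleZ, evZ_cons, evZ_smulZ, evZ_scaleZ m cs s, evZ_cons]; ring

/-- The value at `1` is the coefficient sum. [folklore] -/
theorem evZ_one_eq_sum : ∀ P : List ℤ, evZ P 1 = ((P.sum : ℤ) : ℝ)
  | [] => by simp
  | c :: cs => by rw [evZ_cons, evZ_one_eq_sum cs, List.sum_cons]; push_cast; ring

/-- Appending zeros does not change the value. [folklore] -/
theorem evZ_append_replicate_zero : ∀ (P : List ℤ) (k : ℕ) (x : ℝ),
    evZ (P ++ List.replicate k 0) x = evZ P x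
  | [], k, x => by
    induction k with
    | zero => simp
    | succ k ih => rw [List.replicate_succ, List.nil_append, evZ_cons]; rw [List.nil_append] at ih; rw [ih]; simp
  | c :: cs, k, x => by rw [List.cons_append, evZ_cons, evZ_append_replicate_zero cs k x, evZ_cons]

/-- Zero-padding at the top to length (at least) `n`. [folklore] -/
def padZ (n : ℕ) (P : List ℤ) : List ℤ := P ++ List.replicate (n - P.length) 0

/-- `padZ` does not change the value. [folklore] -/
theorem evZ_padZ (n : ℕ) (P : List ℤ) (x : ℝ) : evZ (padZ n P) x = evZ P x :=
  evZ_append_replicate_zero P _ x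

/-- Length of `padZ`. [folklore] -/
theorem length_padZ {n : ℕ} {P : List ℤ} (h : P.length ≤ n) : (padZ n P).length = n := by
  simp [padZ, h]

/-! ## §2 The `(1+u)`-transform and positivity on `[0,1)` -/

/-- Coefficient list of `(1+u)^k`. [folklore] -/
def onePlusPow : ℕ → List ℤ
  | 0 => [1]
  | k + 1 => mulLinZ 1 (onePlusPow k)

/-- `onePlusPow k` is `(1+u)^k`. [folklore] -/
theorem evZ_onePlusPow (u : ℝ) : ∀ k, evZ (onePlusPow k) u = (1 + u) ^ k
  | 0 => by simp [onePlusPow]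
  | k + 1 => by rw [onePlusPow, evZ_mulLinZ, evZ_onePlusPow u k]; push_cast; ring

/-- The `G`-transform `bernG [q₀,…,q_n] = Σ_j q_j u^j (1+u)^{n-j}` (so that `G(u) = (1+u)^n Q(u/(1+u))`). [folklore] -/
def bernG : List ℤ → List ℤ
  | [] => []
  | c :: cs => addZ (smulZ c (onePlusPow cs.length)) (0 :: bernG cs)

/-- **The transform identity** `G(u) = (1+u)^n Q(u/(1+u))`. [folklore] -/
theorem evZ_bernG {u : ℝ} (hu : 1 + u ≠ 0) :
    ∀ P : List ℤ, evZ (bernG P) u = (1 + u) ^ (P.length - 1) * evZ P (u / (1 + u))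
  | [] => by simp [bernG]
  | c :: cs => by
    rw [bernG, evZ_addZ, evZ_smulZ, evZ_onePlusPow, evZ_cons, evZ_bernG hu cs, evZ_cons]
    cases cs with
    | nil => simp
    | cons c' cs' =>
      simp only [List.length_cons, Nat.add_sub_cancel]
      rw [pow_succ]
      field_simp
      ring

/-- All coefficients non-negative. [folklore] -/
def allNonneg (P : List ℤ) : Bool := P.all fun c => decide (0 ≤ c)

/-- A list with non-negative coefficients is non-negative on `u ≥ 0`. [folklore] -/
theorem evZ_nonneg_of_allNonneg : ∀ {P : List ℤ}, allNonneg P = true → ∀ {u : ℝ}, 0 ≤ u → 0 ≤ evZ P u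
  | [], _, u, _ => by simp
  | c :: cs, h, u, hu => by
    have h' : (0 ≤ c) ∧ allNonneg cs = true := by
      simpa [allNonneg, List.all_cons] using h
    rw [evZ_cons]
    have ih := evZ_nonneg_of_allNonneg h'.2 hu
    have hc : (0 : ℝ) ≤ c := by exact_mod_cast h'.1
    positivity

/-- **Positivity on `[0,1)`** from the `G`-transform. [folklore] -/
theorem evZ_nonneg_of_bernG {P : List ℤ} (h : allNonneg (bernG P) = true) {s : ℝ} (hs0 : 0 ≤ s)
    (hs1 : s < 1) : 0 ≤ evZ P s := by
  have h1s : 0 < 1 - s := by linarith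
  set u := s / (1 - s) with hu
  have hu0 : 0 ≤ u := div_nonneg hs0 h1s.le
  have h1u : (0 : ℝ) < 1 + u := by linarith
  have hsu : u / (1 + u) = s := by
    rw [hu]; field_simp; ring
  have key := evZ_bernG h1u.ne' P
  rw [hsu] at key
  have hG := evZ_nonneg_of_allNonneg h hu0
  rw [key] at hG
  exact (mul_nonneg_iff_of_pos_left (pow_pos h1u _)).1 hG

/-! ## §3 Positivity on a closed rational interval by cells -/

/-- The cell test: `Q ≥ 0` on each cell `[c/N, (c+1)/N)`, `c < N`, by the `G`-transform of `N^n Q((c+s)/N)`. [folklore] -/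
def cellsOK (N : ℕ) (Q : List ℤ) : Bool :=
  (List.range N).all fun c => allNonneg (bernG (shiftH (c : ℤ) (N : ℤ) Q))

/-- Soundness of the cell test on `[0,1)`. [folklore] -/
theorem evZ_nonneg_of_cellsOK {N : ℕ} (hN : 0 < N) {Q : List ℤ} (h : cellsOK N Q = true) {t : ℝ}
    (ht0 : 0 ≤ t) (ht1 : t < 1) : 0 ≤ evZ Q t := by
  have hN' : (0 : ℝ) < N := by exact_mod_cast hN
  set c : ℕ := ⌊(N : ℝ) * t⌋₊ with hc
  have hNt : 0 ≤ (N : ℝ) * t := by positivity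
  have hct : (c : ℝ) ≤ N * t := Nat.floor_le hNt
  have htc : (N : ℝ) * t < c + 1 := Nat.lt_floor_add_one _
  have hcN : c < N := by
    have h1 : (c : ℝ) < N := lt_of_le_of_lt hct (by nlinarith)
    exact_mod_cast h1
  have hcell : allNonneg (bernG (shiftH (c : ℤ) (N : ℤ) Q)) = true := by
    rw [cellsOK, List.all_eq_true] at h
    exact h c (List.mem_range.2 hcN)
  have hs0 : 0 ≤ (N : ℝ) * t - c := by linarith
  have hs1 : (N : ℝ) * t - c < 1 := by linarith
  have hpos := evZ_nonneg_of_bernG hcell hs0 hs1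
  rw [evZ_shiftH (c : ℤ) (N : ℤ) (by push_cast; exact hN'.ne') Q] at hpos
  have ht : (((c : ℤ) : ℝ) + ((N : ℝ) * t - c)) / ((N : ℤ) : ℝ) = t := by
    push_cast; field_simp; ring
  rw [ht] at hpos
  exact (mul_nonneg_iff_of_pos_left (pow_pos (by push_cast; exact hN') _)).1 hpos

/-- **The positivity test on `[a/D, (a+m)/D]`**: affine substitution to `[0,1]`, cells, coefficient sum at `t = 1`. [folklore] -/
def posOn (a m : ℤ) (D N : ℕ) (P : List ℤ) : Bool :=
  cellsOK N (scaleZ m (shiftH a D P)) && decide (0 ≤ (scaleZ m (shiftH a D P)).sum)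

/-- **Soundness of `posOn`**: `posOn a m D N P = true` gives `P ≥ 0` on `[a/D, (a+m)/D]`. [folklore] -/
theorem evZ_nonneg_of_posOn {a m : ℤ} {D N : ℕ} (hD : 0 < D) (hm : 0 < m) (hN : 0 < N) {P : List ℤ}
    (h : posOn a m D N P = true) {x : ℝ} (h1 : (a : ℝ) / D ≤ x) (h2 : x ≤ ((a : ℝ) + m) / D) :
    0 ≤ evZ P x := by
  rw [posOn, Bool.and_eq_true, decide_eq_true_eq] at h
  obtain ⟨hcells, hsum⟩ := h
  have hD' : (0 : ℝ) < D := by exact_mod_cast hD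
  have hm' : (0 : ℝ) < m := by exact_mod_cast hm
  set t := ((D : ℝ) * x - a) / m with ht
  have hDx1 : (a : ℝ) ≤ D * x := by rwa [div_le_iff₀ hD', mul_comm] at h1
  have hDx2 : (D : ℝ) * x ≤ a + m := by rwa [le_div_iff₀ hD', mul_comm] at h2
  have ht0 : 0 ≤ t := div_nonneg (by linarith) hm'.le
  have ht1 : t ≤ 1 := by rw [ht, div_le_one hm']; linarith
  have hx : (((a : ℤ) : ℝ) + (m : ℝ) * t) / ((D : ℤ) : ℝ) = x := by
    rw [ht]; push_cast; field_simp; ring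
  have key : evZ (scaleZ m (shiftH a D P)) t = ((D : ℤ) : ℝ) ^ (P.length - 1) * evZ P x := by
    rw [evZ_scaleZ, evZ_shiftH (a : ℤ) (D : ℤ) (by push_cast; exact hD'.ne') P, ← hx]
  have hDp : (0 : ℝ) < ((D : ℤ) : ℝ) ^ (P.length - 1) := pow_pos (by push_cast; exact hD') _
  rcases ht1.lt_or_eq with hlt | heq
  · have h0 := evZ_nonneg_of_cellsOK hN hcells ht0 hlt
    rw [key] at h0
    exact (mul_nonneg_iff_of_pos_left hDp).1 h0
  · have h0 : 0 ≤ evZ (scaleZ m (shiftH a D P)) t := by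
      rw [heq, evZ_one_eq_sum]; exact_mod_cast hsum
    rw [key] at h0
    exact (mul_nonneg_iff_of_pos_left hDp).1 h0

/-- The instance used by the strip programme: `posOn 13 2 39 N P` certifies `P ≥ 0` on the enclosure
`[1/3, 5/13]` of `x_c`. [folklore] -/
theorem evZ_nonneg_on_enclosure {N : ℕ} (hN : 0 < N) {P : List ℤ} (h : posOn 13 2 39 N P = true) {x : ℝ}
    (h1 : 1 / 3 ≤ x) (h2 : x ≤ 5 / 13) : 0 ≤ evZ P x :=
  evZ_nonneg_of_posOn (by norm_num) (by norm_num) hN h (by push_cast; linarith) (by push_cast; linarith)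

/-- Smoke test (kernel): `39x - 12 ≥ 0` on `[1/3, 5/13]`… is `x ≥ 12/39`; true. -/
example : posOn 13 2 39 1 [-12, 39] = true := by decide

/-- Smoke test (kernel): `(x - 1/3)(5/13 - x) ≥ 0`, i.e. `-507x² + 364x - 65 ≥ 0` (times 507·…): `[-65, 364, -507]`. -/
example : posOn 13 2 39 1 [-65, 364, -507] = true := by decide

end Summit.CriticalPhenomena.SAWScalingLimit.Theorems.BoundaryTP2.StripCert
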